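import Summits.QuantumFields.GaugeBoot.InvariantSchwingerDysonRows
import Summits.QuantumFields.GaugeBoot.PolynomialSchwingerDyson
import Mathlib.Analysis.Convex.Integral
import Mathlib.Topology.Algebra.Module.FiniteDimension
import HarnessLib

/-!
# Orbit averages of POLYNOMIAL observables are polynomial; invariant polynomial rows suffice (gauge-boot, L1 supplement)

HONEST FRAMING (cell `pub-gaugeboot`, page 1 of every file): the venture produces certified bounds
on lattice expectations at stated coupling, gauge group, dimension and torus size; NOT a mass gap,
NOT a continuum limit, NOT a string tension; NOT Yang–Mills-summit-bearing (barriers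
`FixedCouplingUltralocality`, `PerturbativeInvisibility`). This module is a structural statement
about configuration spaces `ι → G`; it certifies no number.

## Content — the POLYNOMIAL test class for `CentralLoopEquations.lean`

`CentralLoopEquations.lean` works with the test class of ALL gauge-invariant observables
differentiable along the shift. A bootstrap uses gauge-invariant POLYNOMIAL observables (Wilson
loops and their products, `PolynomialObservables.polyFunctions`). The bridge:

* ★ `exists_fg_invariant_of_mem_polyAlgebra` — if a compact group `H` acts on `ι → G` jointly
  continuously and every generator `Re/Im ρ(U_e)_{ab}` lies in a finite-dimensional `H`-stable
  subspace of the polynomial algebra (true for the gauge action: a link variable transforms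
  linearly, `U_e ↦ h_x U_e h_y⁻¹`), then so does EVERY polynomial observable (induction over the
  algebra: sums and products of finite-dimensional stable subspaces are finite-dimensional and
  stable);
* ★★ `orbitAverage_mem_polyFunctions` — hence the ORBIT AVERAGE `∫ f(act h U) dh` of a polynomial
  observable is a polynomial observable (a finite-dimensional subspace is closed, so the
  `C(ι → G, ℝ)`-valued Bochner integral of `h ↦ f ∘ act h` stays in it — `Convex.integral_mem`);
* ★ `hasDerivAt_orbitAverage_comp_flow` — orbit averaging commutes with differentiation along a
  flow commuting with the action (differentiation under the integral, via the orbit measure);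
* ★★ `IsSchwingerDysonStateOn.isPolySchwingerDysonState_of_invariant` — for an `act`-INVARIANT
  finite measure, shifts commuting with the action, invariant local actions: the Schwinger–Dyson
  rows for the INVARIANT POLYNOMIAL test functions imply the rows for ALL polynomial test functions
  (`IsPolySchwingerDysonState`, hence — `PolynomialSchwingerDyson` — all rows, Wilson, DLR);
* ★★ `IsSchwingerDysonStateOn.avgMeasure_of_le_invariant` — for ANY finite measure the rows for a
  class of invariant test functions pass to the averaged state `avgMeasure`.

The sequel `AbelianPolynomialLoopEquations.lean` instantiates the gauge action: for `U(1)` the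
loop equations with gauge-invariant polynomial test functions plus realisability determine every
gauge-invariant expectation (torus) / characterise the DLR states (`ℤ^d`).

References: Z. Li, S. Zhou, arXiv:2404.17071 §2; P. Anderson, M. Kruczenski, Nucl. Phys. B 921
(2017) §2. Folklore.
-/

noncomputable section

open MeasureTheory
open Literature.MathematicalPhysics.QuantumFieldTheory (haarProbability LatticeRep)

namespace Summit.QuantumFields.GaugeBoot

variable {H : Type*} [Group H] [TopologicalSpace H] [IsTopologicalGroup H] [CompactSpace H]
  [MeasurableSpace H] [BorelSpace H] [SecondCountableTopology H]

/-! ## The maps of a jointly continuous action as continuous self-maps -/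

section ActCM

variable {Ω : Type*} [TopologicalSpace Ω] {act : H → Ω → Ω}

/-- The map `act h` of a jointly continuous action as a continuous self-map of `Ω`. [folklore] -/
def actCM (act : H → Ω → Ω) (hact : Continuous fun p : H × Ω => act p.1 p.2) (h : H) : C(Ω, Ω) :=
  ⟨act h, hact.comp (continuous_const.prodMk continuous_id)⟩

omit [Group H] [IsTopologicalGroup H] [CompactSpace H] [MeasurableSpace H] [BorelSpace H]
  [SecondCountableTopology H] in
/-- `actCM` evaluated. -/
@[simp] theorem actCM_apply (hact : Continuous fun p : H × Ω => act p.1 p.2) (h : H) (x : Ω) :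
    actCM act hact h x = act h x := rfl

omit [Group H] [IsTopologicalGroup H] [CompactSpace H] [MeasurableSpace H] [BorelSpace H]
  [SecondCountableTopology H] in
/-- `h ↦ act h` is continuous into `C(Ω, Ω)` (currying). [folklore] -/
theorem continuous_actCM (hact : Continuous fun p : H × Ω => act p.1 p.2) :
    Continuous (actCM act hact) :=
  (ContinuousMap.curry ⟨fun p : H × Ω => act p.1 p.2, hact⟩).continuous

omit [Group H] [IsTopologicalGroup H] [CompactSpace H] [MeasurableSpace H] [BorelSpace H]
  [SecondCountableTopology H] in
/-- `h ↦ f ∘ act h` is continuous into `C(Ω, ℝ)` for every continuous observable `f` (compact `Ω`).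
[folklore] -/
theorem continuous_comp_actCM [CompactSpace Ω] (hact : Continuous fun p : H × Ω => act p.1 p.2)
    (f : C(Ω, ℝ)) : Continuous fun h => f.comp (actCM act hact h) :=
  (ContinuousMap.continuous_postcomp f).comp (continuous_actCM hact)

end ActCM

/-! ## Finite-dimensional stable subspaces of the polynomial algebra -/

section Poly

variable {ι : Type*} {G : Type*} [Group G] [TopologicalSpace G] [CompactSpace G]
  (r : LatticeRep G) {act : H → (ι → G) → (ι → G)}

omit [Group H] [IsTopologicalGroup H] [CompactSpace H] [MeasurableSpace H] [BorelSpace H]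
  [SecondCountableTopology H] [CompactSpace G] in
/-- ★ **Every polynomial observable lies in a finite-dimensional `H`-stable subspace of the
polynomial algebra**, provided every generator does (`hgen`). Induction over `Algebra.adjoin`:
constants span the stable line `ℝ·1`; for sums take `W₁ ⊔ W₂`, for products `W₁ * W₂`
(`Submodule.FG.sup`, `Submodule.FG.mul`, `Submodule.map_mul`). [folklore] -/
theorem exists_fg_invariant_of_mem_polyAlgebra (hact : Continuous fun p : H × (ι → G) => act p.1 p.2)
    (hgen : ∀ g ∈ entryGens (ι := ι) r, ∃ W : Submodule ℝ C(ι → G, ℝ), W.FG ∧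
      W ≤ Subalgebra.toSubmodule (polyAlgebra (ι := ι) r) ∧ g ∈ W ∧
      ∀ h : H, W.map (ContinuousMap.compRightAlgHom ℝ ℝ (actCM act hact h)).toLinearMap ≤ W)
    {f : C(ι → G, ℝ)} (hf : f ∈ polyAlgebra (ι := ι) r) :
    ∃ W : Submodule ℝ C(ι → G, ℝ), W.FG ∧ W ≤ Subalgebra.toSubmodule (polyAlgebra (ι := ι) r) ∧
      f ∈ W ∧ ∀ h : H, W.map (ContinuousMap.compRightAlgHom ℝ ℝ (actCM act hact h)).toLinearMap ≤ W := by
  induction hf using Algebra.adjoin_induction with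
  | mem g hg => exact hgen g hg
  | algebraMap c =>
      refine ⟨Submodule.span ℝ {(1 : C(ι → G, ℝ))}, Submodule.fg_span (Set.finite_singleton _),
        Submodule.span_le.2 (Set.singleton_subset_iff.2 (Subalgebra.one_mem (polyAlgebra (ι := ι) r))),
        ?_,
        fun h => ?_⟩
      · rw [Algebra.algebraMap_eq_smul_one]
        exact Submodule.smul_mem _ _ (Submodule.subset_span rfl)
      · rw [Submodule.map_span, Submodule.span_le]
        rintro _ ⟨x, hx, rfl⟩
        rw [Set.mem_singleton_iff.1 hx]
        exact Submodule.subset_span (by ext U; simp)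
  | add f g _ _ ihf ihg =>
      obtain ⟨W₁, h1fg, h1le, h1mem, h1inv⟩ := ihf
      obtain ⟨W₂, h2fg, h2le, h2mem, h2inv⟩ := ihg
      refine ⟨W₁ ⊔ W₂, h1fg.sup h2fg, sup_le h1le h2le, Submodule.add_mem_sup h1mem h2mem,
        fun h => ?_⟩
      rw [Submodule.map_sup]
      exact sup_le_sup (h1inv h) (h2inv h)
  | mul f g _ _ ihf ihg =>
      obtain ⟨W₁, h1fg, h1le, h1mem, h1inv⟩ := ihf
      obtain ⟨W₂, h2fg, h2le, h2mem, h2inv⟩ := ihg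
      refine ⟨W₁ * W₂, h1fg.mul h2fg, Submodule.mul_le.2 fun m hm n hn =>
        Subalgebra.mul_mem _ (h1le hm) (h2le hn), Submodule.mul_mem_mul h1mem h2mem, fun h => ?_⟩
      rw [Submodule.map_mul]
      exact mul_le_mul' (h1inv h) (h2inv h)

variable [MeasurableSpace G] [BorelSpace G] [IsTopologicalGroup G] [SecondCountableTopology G]
  [Countable ι]

omit [SecondCountableTopology H] [MeasurableSpace G] [BorelSpace G] in
/-- ★★ **The `C(ι → G, ℝ)`-valued orbit average of a polynomial observable is a polynomial
observable**: `∫ f ∘ act h dh ∈ polyAlgebra r`. The integrand stays in the finite-dimensional, hence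
closed, stable subspace of `exists_fg_invariant_of_mem_polyAlgebra`; closed convex sets are stable
under Bochner averaging (`Convex.integral_mem`). [folklore] -/
theorem integral_comp_actCM_mem_polyAlgebra (hact : Continuous fun p : H × (ι → G) => act p.1 p.2)
    (hgen : ∀ g ∈ entryGens (ι := ι) r, ∃ W : Submodule ℝ C(ι → G, ℝ), W.FG ∧
      W ≤ Subalgebra.toSubmodule (polyAlgebra (ι := ι) r) ∧ g ∈ W ∧
      ∀ h : H, W.map (ContinuousMap.compRightAlgHom ℝ ℝ (actCM act hact h)).toLinearMap ≤ W)
    {f : C(ι → G, ℝ)} (hf : f ∈ polyAlgebra (ι := ι) r) :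
    (∫ h, f.comp (actCM act hact h) ∂haarProbability H) ∈ polyAlgebra (ι := ι) r := by
  obtain ⟨W, hWfg, hWle, hfW, hWinv⟩ := exists_fg_invariant_of_mem_polyAlgebra r hact hgen hf
  haveI : FiniteDimensional ℝ W := (Submodule.fg_iff_finiteDimensional W).1 hWfg
  have hclosed : IsClosed (W : Set C(ι → G, ℝ)) := W.closed_of_finiteDimensional
  have hmemW : ∀ h, f.comp (actCM act hact h) ∈ W := fun h =>
    hWinv h (Submodule.mem_map_of_mem hfW)
  have hint : Integrable (fun h => f.comp (actCM act hact h)) (haarProbability H) :=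
    (continuous_comp_actCM hact f).integrable_of_hasCompactSupport
      (IsCompact.of_isClosed_subset isCompact_univ (isClosed_tsupport _) (Set.subset_univ _))
  exact hWle (W.convex.integral_mem hclosed (ae_of_all _ hmemW) hint)

omit [SecondCountableTopology H] [MeasurableSpace G] [BorelSpace G] in
/-- The `C(ι → G, ℝ)`-valued orbit average evaluated at a configuration is the orbit average of
`GroupAveraging.lean`. [folklore] -/
theorem integral_comp_actCM_apply (hact : Continuous fun p : H × (ι → G) => act p.1 p.2)
    (f : C(ι → G, ℝ)) (U : ι → G) :
    (∫ h, f.comp (actCM act hact h) ∂haarProbability H) U = orbitAverage act f U := by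
  have hint : Integrable (fun h => f.comp (actCM act hact h)) (haarProbability H) :=
    (continuous_comp_actCM hact f).integrable_of_hasCompactSupport
      (IsCompact.of_isClosed_subset isCompact_univ (isClosed_tsupport _) (Set.subset_univ _))
  have h := ((ContinuousMap.evalCLM ℝ U).integral_comp_comm hint).symm
  simpa [orbitAverage] using h

omit [SecondCountableTopology H] [MeasurableSpace G] [BorelSpace G] in
/-- ★★ **Orbit averages of polynomial observables are polynomial observables** (function form).
[folklore] -/
theorem orbitAverage_mem_polyFunctions (hact : Continuous fun p : H × (ι → G) => act p.1 p.2)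
    (hgen : ∀ g ∈ entryGens (ι := ι) r, ∃ W : Submodule ℝ C(ι → G, ℝ), W.FG ∧
      W ≤ Subalgebra.toSubmodule (polyAlgebra (ι := ι) r) ∧ g ∈ W ∧
      ∀ h : H, W.map (ContinuousMap.compRightAlgHom ℝ ℝ (actCM act hact h)).toLinearMap ≤ W)
    {f : (ι → G) → ℝ} (hf : f ∈ polyFunctions (ι := ι) r) :
    orbitAverage act f ∈ polyFunctions (ι := ι) r := by
  obtain ⟨f₀, hf₀, rfl⟩ := (mem_polyFunctions_iff r).1 hf
  refine (mem_polyFunctions_iff r).2 ⟨_, integral_comp_actCM_mem_polyAlgebra r hact hgen hf₀, ?_⟩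
  funext U
  exact integral_comp_actCM_apply hact f₀ U

end Poly

/-! ## Orbit averaging commutes with differentiation along a commuting flow -/

section Deriv

variable {Ω : Type*} [TopologicalSpace Ω] [MeasurableSpace Ω] [BorelSpace Ω] [CompactSpace Ω]
  {act : H → Ω → Ω}

omit [SecondCountableTopology H] in
/-- ★ **Differentiation under the orbit average.** `T` a continuous flow commuting with the jointly
continuous action, `f` continuous with a continuous flow derivative `f'` at every point: then
`t ↦ orbitAverage f (T_t x)` has derivative `orbitAverage f' x` at `0` (the flow acts on the ORBIT
MEASURE `dh ∘ (h ↦ act h x)⁻¹`; `PolynomialSchwingerDysonSeries.hasDerivAt_integral_comp_flow_mul`).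
[folklore] -/
theorem hasDerivAt_orbitAverage_comp_flow (hact : Continuous fun p : H × Ω => act p.1 p.2)
    {T : ℝ → Ω → Ω} (hT : IsContinuousFlow T) (hcomm : ∀ h t x, act h (T t x) = T t (act h x))
    {f f' : Ω → ℝ} (hf : Continuous f) (hf' : Continuous f')
    (hd : ∀ x, HasDerivAt (fun t => f (T t x)) (f' x) 0) (x : Ω) :
    HasDerivAt (fun t => orbitAverage act f (T t x)) (orbitAverage act f' x) 0 := by
  have hm : Measurable fun h : H => act h x :=
    (hact.comp (continuous_id.prodMk continuous_const)).measurable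
  set ν : Measure Ω := (haarProbability H).map fun h => act h x with hν
  haveI : IsFiniteMeasure ν := Measure.isFiniteMeasure_map _ _
  have key := hasDerivAt_integral_comp_flow_mul hT ν continuous_const hf hf' hd (w := fun _ => (1:ℝ))
  have h1 : (fun t => ∫ y, f (T t y) * (1 : ℝ) ∂ν) = fun t => orbitAverage act f (T t x) := by
    funext t
    have hc : Continuous fun y => f (T t y) * (1 : ℝ) :=
      (hf.comp (hT.continuous_right t)).mul continuous_const
    have e1 : ∫ y, f (T t y) * (1 : ℝ) ∂ν = ∫ h, f (T t (act h x)) * (1 : ℝ) ∂haarProbability H := by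
      rw [hν]
      exact integral_map hm.aemeasurable hc.aestronglyMeasurable
    rw [e1]
    simp [orbitAverage, hcomm]
  have h2 : ∫ y, f' y * (1 : ℝ) ∂ν = orbitAverage act f' x := by
    have hc : Continuous fun y => f' y * (1 : ℝ) := hf'.mul continuous_const
    have e2 : ∫ y, f' y * (1 : ℝ) ∂ν = ∫ h, f' (act h x) * (1 : ℝ) ∂haarProbability H := by
      rw [hν]
      exact integral_map hm.aemeasurable hc.aestronglyMeasurable
    rw [e2]
    simp [orbitAverage]
  rw [h1, h2] at key
  exact key

end Deriv

/-! ## Invariant polynomial rows ⇒ all polynomial rows (invariant state); rows pass to the average -/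

section Rows

variable {ι : Type*} [DecidableEq ι] [Countable ι] {G : Type*} [Group G] [TopologicalSpace G]
  [IsTopologicalGroup G] [CompactSpace G] [MeasurableSpace G] [BorelSpace G]
  [SecondCountableTopology G] (r : LatticeRep G) {K : Type*} {k : K → ℝ → G}
  {S : ι → (ι → G) → ℝ} {β : ℝ} {act : H → (ι → G) → (ι → G)}

omit [Countable ι] [IsTopologicalGroup G] [CompactSpace G] [BorelSpace G] [SecondCountableTopology G] in
/-- `IsPolySchwingerDysonState` is `IsSchwingerDysonStateOn` for the class of polynomial observables.
[folklore] -/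
theorem isPolySchwingerDysonState_iff_on {μ : Measure (ι → G)} :
    IsPolySchwingerDysonState r k S β μ ↔
      IsSchwingerDysonStateOn (fun f => f ∈ polyFunctions (ι := ι) r) k S β μ := by
  constructor
  · intro h i a
    obtain ⟨S', h1, h2, h3⟩ := h i a
    exact ⟨S', h1, h2, fun f f' hf _ hf' hd => h3 f hf f' hf' hd⟩
  · intro h i a
    obtain ⟨S', h1, h2, h3⟩ := h i a
    exact ⟨S', h1, h2, fun f hf f' hf' hd => h3 f f' hf (continuous_of_mem_polyFunctions r hf) hf' hd⟩

/-- ★★ **Invariant state: the rows for INVARIANT POLYNOMIAL test functions imply the rows for ALL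
polynomial test functions.** `H` compact acting jointly continuously with every generator in a
finite-dimensional stable subspace of the polynomial algebra (`hgen`), `μ` finite and
`act`-invariant, the one-link shifts of the family commuting with the action, invariant local
actions. For a polynomial `f` with flow derivative `f'`, the row for the invariant polynomial
`orbitAverage f` (flow derivative `orbitAverage f'`) IS the row for `f`, since `μ` integrates orbit
averages like the originals. [folklore] -/
theorem IsSchwingerDysonStateOn.isPolySchwingerDysonState_of_invariant
    (hkc : ∀ a, Continuous (k a)) (hk : ∀ a s t, k a (s + t) = k a s * k a t)
    (hact : Continuous fun p : H × (ι → G) => act p.1 p.2)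
    (hmul : ∀ h h' U, act (h * h') U = act h (act h' U))
    (hgen : ∀ g ∈ entryGens (ι := ι) r, ∃ W : Submodule ℝ C(ι → G, ℝ), W.FG ∧
      W ≤ Subalgebra.toSubmodule (polyAlgebra (ι := ι) r) ∧ g ∈ W ∧
      ∀ h : H, W.map (ContinuousMap.compRightAlgHom ℝ ℝ (actCM act hact h)).toLinearMap ≤ W)
    (hcomm : ∀ (h : H) (i : ι) (a : K) (t : ℝ) (U : ι → G),
      act h (Function.update U i (k a t * U i)) = Function.update (act h U) i (k a t * act h U i))
    (hSinv : ∀ (h : H) (i : ι) (U : ι → G), S i (act h U) = S i U) {μ : Measure (ι → G)}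
    [IsFiniteMeasure μ] (hμinv : ∀ h, μ.map (act h) = μ)
    (hμ : IsSchwingerDysonStateOn
      (fun f => f ∈ polyFunctions (ι := ι) r ∧ ∀ h U, f (act h U) = f U) k S β μ) :
    IsPolySchwingerDysonState r k S β μ := by
  intro i a
  obtain ⟨S', hS'c, hS', hsd⟩ := hμ i a
  refine ⟨S', hS'c, hS', fun f hf f' hf' hd => ?_⟩
  have hfc : Continuous f := continuous_of_mem_polyFunctions r hf
  have hS'i : ∀ h U, S' (act h U) = S' U := fun h U => by
    have h1 := hS' (act h U)
    simp only [← hcomm, hSinv] at h1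
    exact h1.unique (hS' U)
  -- the invariant polynomial `g = orbitAverage f` and its flow derivative `orbitAverage f'`
  have hg : orbitAverage act f ∈ polyFunctions (ι := ι) r := orbitAverage_mem_polyFunctions r hact hgen hf
  have hgi : ∀ h U, orbitAverage act f (act h U) = orbitAverage act f U := orbitAverage_act hmul f
  have hgc : Continuous (orbitAverage act f) := continuous_orbitAverage hact hfc
  have hg'c : Continuous (orbitAverage act f') := continuous_orbitAverage hact hf'
  have hgd : ∀ U, HasDerivAt (fun t => orbitAverage act f (Function.update U i (k a t * U i)))
      (orbitAverage act f' U) 0 := fun U =>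
    hasDerivAt_orbitAverage_comp_flow hact (isContinuousFlow_update_mul (hkc a) (hk a) i)
      (fun h t U => hcomm h i a t U) hfc hf' hd U
  have row := hsd (orbitAverage act f) (orbitAverage act f') ⟨hg, hgi⟩ hgc hg'c hgd
  have e1 : ∫ U, orbitAverage act f' U ∂μ = ∫ U, f' U ∂μ :=
    integral_orbitAverage_eq_of_map_eq hact hf' μ hμinv
  have e2 : ∫ U, orbitAverage act f U * S' U ∂μ = ∫ U, f U * S' U ∂μ := by
    have h3 := integral_orbitAverage_eq_of_map_eq hact (F := fun U => f U * S' U) (hfc.mul hS'c)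
      μ hμinv
    rw [orbitAverage_mul_of_invariant f hS'i] at h3
    exact h3
  rw [e1, e2] at row
  exact row

omit [IsTopologicalGroup G] in
/-- ★★ **The rows for a class of INVARIANT test functions pass to the averaged state** (any class
`P` of `act`-invariant observables; shifts commuting with the action, invariant local actions,
`μ` finite): generalises `IsSchwingerDysonStateOn.avgMeasure` (class = all invariant observables).
[folklore] -/
theorem IsSchwingerDysonStateOn.avgMeasure_of_le_invariant {P : ((ι → G) → ℝ) → Prop}
    (hP : ∀ f, P f → ∀ h U, f (act h U) = f U) {μ : Measure (ι → G)} [IsFiniteMeasure μ]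
    (hμ : IsSchwingerDysonStateOn P k S β μ) (hact : Continuous fun p : H × (ι → G) => act p.1 p.2)
    (hcomm : ∀ (h : H) (i : ι) (a : K) (t : ℝ) (U : ι → G),
      act h (Function.update U i (k a t * U i)) = Function.update (act h U) i (k a t * act h U i))
    (hSinv : ∀ (h : H) (i : ι) (U : ι → G), S i (act h U) = S i U) :
    IsSchwingerDysonStateOn P k S β (GaugeBoot.avgMeasure act μ) := by
  intro i a
  obtain ⟨S', hS'c, hS', hsd⟩ := hμ i a
  refine ⟨S', hS'c, hS', fun f f' hfP hf hf' hd => ?_⟩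
  have hfi : ∀ h U, f (act h U) = f U := hP f hfP
  have hf'i : ∀ h U, f' (act h U) = f' U := fun h U => by
    have h1 := hd (act h U)
    simp only [← hcomm, hfi] at h1
    exact h1.unique (hd U)
  have hS'i : ∀ h U, S' (act h U) = S' U := fun h U => by
    have h1 := hS' (act h U)
    simp only [← hcomm, hSinv] at h1
    exact h1.unique (hS' U)
  haveI := isFiniteMeasure_avgMeasure (act := act) μ
  rw [integral_avgMeasure_of_invariant hact hf' hf'i μ,
    integral_avgMeasure_of_invariant hact (F := fun U => f U * S' U) (hf.mul hS'c)
      (fun h U => by simp only [hfi, hS'i]) μ]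
  exact hsd f f' hfP hf hf' hd

/-- ★★ **Any state: invariant polynomial rows for `μ` ⇒ ALL polynomial rows for the averaged state
`avgMeasure act μ`.** [folklore] -/
theorem IsSchwingerDysonStateOn.isPolySchwingerDysonState_avgMeasure
    (hkc : ∀ a, Continuous (k a)) (hk : ∀ a s t, k a (s + t) = k a s * k a t)
    (hact : Continuous fun p : H × (ι → G) => act p.1 p.2)
    (hmul : ∀ h h' U, act (h * h') U = act h (act h' U))
    (hgen : ∀ g ∈ entryGens (ι := ι) r, ∃ W : Submodule ℝ C(ι → G, ℝ), W.FG ∧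
      W ≤ Subalgebra.toSubmodule (polyAlgebra (ι := ι) r) ∧ g ∈ W ∧
      ∀ h : H, W.map (ContinuousMap.compRightAlgHom ℝ ℝ (actCM act hact h)).toLinearMap ≤ W)
    (hcomm : ∀ (h : H) (i : ι) (a : K) (t : ℝ) (U : ι → G),
      act h (Function.update U i (k a t * U i)) = Function.update (act h U) i (k a t * act h U i))
    (hSinv : ∀ (h : H) (i : ι) (U : ι → G), S i (act h U) = S i U) {μ : Measure (ι → G)}
    [IsFiniteMeasure μ] [HasOuterApproxClosed (ι → G)]
    (hμ : IsSchwingerDysonStateOn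
      (fun f => f ∈ polyFunctions (ι := ι) r ∧ ∀ h U, f (act h U) = f U) k S β μ) :
    IsPolySchwingerDysonState r k S β (GaugeBoot.avgMeasure act μ) := by
  haveI := isFiniteMeasure_avgMeasure (act := act) μ
  exact (hμ.avgMeasure_of_le_invariant (fun _ hf => hf.2) hact hcomm hSinv).isPolySchwingerDysonState_of_invariant
    r hkc hk hact hmul hgen hcomm hSinv (map_avgMeasure_act hmul hact μ)

end Rows

end Summit.QuantumFields.GaugeBoot

end
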